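import Summits.HodgeConjecture.HodgeCM.Automorphic.KernelModelHeisenbergPair_1

/-! PORT of `HodgeCM/Automorphic/KernelModelHeisenbergPair.lean` (HodgeCMPerL run 82) — part 2: continuation of `Summits.HodgeConjecture.HodgeCM.Automorphic.KernelModelHeisenbergPair_1` (split at a top-level declaration boundary by port_pkg.py; scope re-opened below; declarations unchanged). -/

-- port_pkg: scope re-opened for this part (file-level context, then the namespace/section stack open at the cut)
set_option autoImplicit false
noncomputable section
open MeasureTheory Topology
open HodgeCM.PerL34 HodgeCM.PerL34.Annihilation
open scoped RealInnerProductSpace FourierTransform SchwartzMap CompactlySupported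
attribute [-instance] Quotient.instMeasurableSpace
namespace HodgeCM
namespace SchwartzWeil
namespace HeisenbergPair
open HeisenbergKernel
section Model
variable (V : Type) [NormedAddCommGroup V] [InnerProductSpace ℝ V] [FiniteDimensional ℝ V] [MeasurableSpace V]
  [BorelSpace V] (K : Submodule ℝ V) (L₁ : Submodule ℤ K) [DiscreteTopology L₁] (L₂ : Submodule ℤ Kᗮ)
  [DiscreteTopology L₂] (m : ℤ)
/-- **The kernel on representatives**: `θ_Φ(xΓ₁, yΓ₂) = Θ_Φ(s((x, y)⁻¹)) = Θ_Φ(incl₁ x⁻¹ · incl₂ y⁻¹)` — a function of two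
non-commutative variables. -/
theorem pairModel_θ_mk (Φ : 𝓢(V, ℂ)) (x : Heis K) (y : Heis Kᗮ) :
    (pairModel V K L₁ L₂ m).θ ⟨Φ, Set.mem_univ Φ⟩ (QuotientGroup.mk x, QuotientGroup.mk y) =
      thetaH V (lat V K L₁ L₂) m Φ (incl₁ V K x⁻¹ * incl₂ V K y⁻¹) := by
  rw [WeilThetaModel.θ_mk]
  rfl

/-- … `= Θ_Φ(incl₂ y⁻¹ · incl₁ x⁻¹)` (the two members commute). -/
theorem pairModel_θ_mk' (Φ : 𝓢(V, ℂ)) (x : Heis K) (y : Heis Kᗮ) :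
    (pairModel V K L₁ L₂ m).θ ⟨Φ, Set.mem_univ Φ⟩ (QuotientGroup.mk x, QuotientGroup.mk y) =
      thetaH V (lat V K L₁ L₂) m Φ (incl₂ V K y⁻¹ * incl₁ V K x⁻¹) := by
  rw [pairModel_θ_mk, incl₁_mul_incl₂]

/-- The kernel along the Schrödinger torus of `U(W)`: `θ_Φ(xΓ₁, (jT t)⁻¹Γ₂) = Θ_Φ(incl₁ x⁻¹ · incl₂ (a, 0, u))`, `t = (a, u)`. -/
theorem pairModel_θ_torus (Φ : 𝓢(V, ℂ)) (x : Heis K) (t : Multiplicative Kᗮ × Circle) :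
    (pairModel V K L₁ L₂ m).θ ⟨Φ, Set.mem_univ Φ⟩
        (QuotientGroup.mk x, QuotientGroup.mk (Heis.ofSchrodinger t)⁻¹) =
      thetaH V (lat V K L₁ L₂) m Φ (incl₁ V K x⁻¹ * incl₂ V K (Heis.ofSchrodinger t)) := by
  rw [pairModel_θ_mk, inv_inv]

/-- **The kernel along the torus at the origin of `[G_U]`, computed**: `θ_Φ(1, (jT(a, u))⁻¹Γ₂) = uᵐ Σ_{v ∈ L} Φ(v − a)`. -/
theorem pairModel_θ_one_torus (Φ : 𝓢(V, ℂ)) (t : Multiplicative Kᗮ × Circle) :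
    (pairModel V K L₁ L₂ m).θ ⟨Φ, Set.mem_univ Φ⟩
        (QuotientGroup.mk 1, QuotientGroup.mk (Heis.ofSchrodinger t)⁻¹) =
      (t.2 : ℂ) ^ m * ∑' v : lat V K L₁ L₂, Φ ((v : V) - ((Multiplicative.toAdd t.1 : Kᗮ) : V)) := by
  rw [pairModel_θ_torus, inv_one, map_one, one_mul, thetaH_eq]
  simp only [incl₂_a, incl₂_b, incl₂_u, Heis.ofSchrodinger_a, Heis.ofSchrodinger_b, Heis.ofSchrodinger_u,
    Submodule.coe_zero, smul_zero, inner_zero_left, AddChar.map_zero_eq_one, Circle.coe_one, one_mul]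

/-- For `x = (a₁, b₁, u₁) ∈ Heis K` and `t = (a, u)`: `θ_Φ(xΓ₁, (jT t)⁻¹Γ₂) = uᵐ u₁⁻ᵐ 𝐞(-⟪a₁, b₁⟫)ᵐ Σ_{v ∈ L} 𝐞(-m⟪b₁, v⟫) Φ(v + a₁ − a)`
— the `G_U`-variable enters through a translation by `a₁ ∈ K` and a modulation by `b₁ ∈ K`, orthogonally to the torus
variable `a ∈ Kᗮ`. -/
theorem pairModel_θ_torus_eq (Φ : 𝓢(V, ℂ)) (x : Heis K) (t : Multiplicative Kᗮ × Circle) :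
    (pairModel V K L₁ L₂ m).θ ⟨Φ, Set.mem_univ Φ⟩
        (QuotientGroup.mk x, QuotientGroup.mk (Heis.ofSchrodinger t)⁻¹) =
      (t.2 : ℂ) ^ m * ((x.u : ℂ) ^ m)⁻¹ * ((𝐞 (-⟪x.a, x.b⟫) : Circle) : ℂ) ^ m *
        ∑' v : lat V K L₁ L₂, (𝐞 (-⟪(m : ℝ) • (x.b : V), (v : V)⟫) : ℂ) *
          Φ ((v : V) + (x.a : V) - ((Multiplicative.toAdd t.1 : Kᗮ) : V)) := by
  rw [pairModel_θ_torus, thetaH_eq]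
  simp only [Heis.mul_a, Heis.mul_b, Heis.mul_u, incl₁_a, incl₁_b, incl₁_u, Heis.inv_a,
    Heis.inv_b, Heis.inv_u, Heis.ofSchrodinger_a, Heis.ofSchrodinger_b, Heis.ofSchrodinger_u,
    Submodule.coe_zero, add_zero, Submodule.coe_neg, smul_neg, inner_neg_left, inner_zero_right, neg_zero,
    AddChar.map_zero_eq_one, mul_one, Circle.coe_mul, Circle.coe_inv, mul_zpow, inv_zpow, Submodule.coe_inner]
  congr 1
  · ring
  · refine tsum_congr fun v => ?_
    congr 2
    abel

end Model

/-! ## 4. The kernel core carrier over the two Heisenberg nilmanifolds -/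

section Core

variable (V : Type) [NormedAddCommGroup V] [InnerProductSpace ℝ V] [FiniteDimensional ℝ V] [MeasurableSpace V]
  [BorelSpace V] (K : Submodule ℝ V) (L₁ : Submodule ℤ K) [DiscreteTopology L₁] [IsZLattice ℝ L₁]
  (L₂ : Submodule ℤ Kᗮ) [DiscreteTopology L₂] [IsZLattice ℝ L₂] (m : ℤ) [NeZero m]

/-- The dual-pair model read over the quotient models `QH K L₁ m`, `QH Kᗮ L₂ m` of the two compact Heisenberg nilmanifolds
(pv15-g5 `QH` = pv14-g5 #7 `heisenbergLatticeModel`; same term). -/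
abbrev W : WeilThetaModel (QH K L₁ m).G (QH K L₁ m).Γ (QH Kᗮ L₂ m).G (QH Kᗮ L₂ m).Γ := pairModel V K L₁ L₂ m

/-- **The kernel core carrier** of the dual-pair model: `ω = ρ_m ∘ incl₂`, `Θ`, `inclCG = periodCLM` of
`[G_U] = Heis K ⧸ arith K L₁ m`, `τ̂ =` the isotypic components of `L²(Heis K ⧸ arith K L₁ m)` (pv15-g2 `KernelModel.core`). -/
abbrev core :=
  KernelModel.core (QH K L₁ m) (QH Kᗮ L₂ m) (W V K L₁ L₂ m).SK (W V K L₁ L₂ m).omg (W V K L₁ L₂ m).θ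

/-- **The three structural laws hold**: `ω(1) = id`, `Θ` continuous, `Θ_{ω(h)Φ}(ξ, q) = Θ_Φ(ξ, h⁻¹ q)` for `h ∈ Heis Kᗮ`. -/
theorem structural :
    (∀ Φ, (core V K L₁ L₂ m).omg 1 Φ = Φ) ∧ Continuous (core V K L₁ L₂ m).θ ∧
      ∀ (h : (QH Kᗮ L₂ m).G) Φ ξ (q : (QH Kᗮ L₂ m).G ⧸ (QH Kᗮ L₂ m).Γ),
        (core V K L₁ L₂ m).θ ((core V K L₁ L₂ m).omg h Φ) (ξ, q) = (core V K L₁ L₂ m).θ Φ (ξ, h⁻¹ • q) :=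
  (W V K L₁ L₂ m).structural_laws

/-- **AX1b(a) for the dual-pair model**: the isotypic components of the regular representation of the Heisenberg group
`Heis K` on `L²` of the NILMANIFOLD `Heis K ⧸ arith K L₁ m` have dense span (prl1-g3/pv15-g2, any quotient model). -/
theorem hatτ_complete : (⨆ j, (core V K L₁ L₂ m).hatτ j).topologicalClosure = ⊤ :=
  KernelModel.core_hatτ_complete (QH K L₁ m) (QH Kᗮ L₂ m) _ _ _

/-- `Θ_{ω(h)Φ}` is the `h`-translate of the family `Θ_Φ`, `h ∈ Heis Kᗮ` (pv15-g2 `KernelCoreCarrier.θ_omg_eq`). -/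
theorem θ_omg_eq (h : (QH Kᗮ L₂ m).G) (Φ : (W V K L₁ L₂ m).SK) :
    (core V K L₁ L₂ m).θ ((core V K L₁ L₂ m).omg h Φ) = KernelOp.translFamily ((core V K L₁ L₂ m).θ Φ) h :=
  (core V K L₁ L₂ m).θ_omg_eq (W V K L₁ L₂ m).θ_omg h Φ

end Core

/-! ## 5. The torus side of `U(W) = Heis Kᗮ`: `T(𝔸) = Kᗮ × U(1)`, `T(L₀) = L₂ × μ_m`, all characters of central weight `u^{-m}` -/

attribute [local instance] borelCircle borelSpace_circle borelT borelSpace_T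

section Torus

variable (V : Type) [NormedAddCommGroup V] [InnerProductSpace ℝ V] [FiniteDimensional ℝ V] [MeasurableSpace V]
  [BorelSpace V] (K : Submodule ℝ V) (L₁ : Submodule ℤ K) [DiscreteTopology L₁] [IsZLattice ℝ L₁]
  (L₂ : Submodule ℤ Kᗮ) [DiscreteTopology L₂] [IsZLattice ℝ L₂] (m : ℤ) [NeZero m]

/-- **The torus-side carrier of the dual-pair model** — pv15-g5's §3 objects at `(Kᗮ, L₂)`: `T(𝔸) := Kᗮ × U(1)` with Haar
measure, `jT = Heis.ofSchrodinger`, the `Λ`-partition of unity `β Kᗮ L₂ m`, compact torus `U(1)` (the centre) with weight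
`u^{-m}`, allowed characters `Xw Kᗮ L₂ m` (all characters of `[T]` with central weight `u^{-m}`), `χᵥ ξ = ξ ∘ π`. -/
def torusCarrier : KernelTorusCarrier (core V K L₁ L₂ m) (Multiplicative Kᗮ × Circle) where
  X := Xw Kᗮ L₂ m
  allowed := fun _ => True
  Tι := Circle
  torus := ⇑((jT Kᗮ).toMonoidHom.comp (MonoidHom.inr (Multiplicative Kᗮ) Circle))
  w := ⇑(weightC m)
  ν := Measure.haar
  jT := jT Kᗮ
  β := β Kᗮ L₂ m
  χv := fun χ => ⟨fun t => dualChar χ.1 (QuotientGroup.mk t), (continuous_dualChar χ.1).comp QuotientGroup.continuous_mk⟩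

/-- (Ported verbatim from the HodgeCMPerL package; no docstring in the source.) -/
theorem torusCarrier_ν : (torusCarrier V K L₁ L₂ m).ν = Measure.haar := rfl

/-- (Ported verbatim from the HodgeCMPerL package; no docstring in the source.) -/
instance isHaarMeasure_ν : (torusCarrier V K L₁ L₂ m).ν.IsHaarMeasure := by
  rw [torusCarrier_ν]; infer_instance
/-- (Ported verbatim from the HodgeCMPerL package; no docstring in the source.) -/
instance isFiniteMeasureOnCompacts_ν : IsFiniteMeasureOnCompacts (torusCarrier V K L₁ L₂ m).ν := inferInstance
/-- (Ported verbatim from the HodgeCMPerL package; no docstring in the source.) -/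
instance isOpenPosMeasure_ν : (torusCarrier V K L₁ L₂ m).ν.IsOpenPosMeasure := inferInstance
/-- (Ported verbatim from the HodgeCMPerL package; no docstring in the source.) -/
instance isMulRightInvariant_ν : (torusCarrier V K L₁ L₂ m).ν.IsMulRightInvariant := inferInstance

/-- (Ported verbatim from the HodgeCMPerL package; no docstring in the source.) -/
theorem pt_eq (t : Multiplicative Kᗮ × Circle) :
    (torusCarrier V K L₁ L₂ m).pt t = QuotientGroup.mk (Heis.ofSchrodinger t)⁻¹ := rfl

/-- (Ported verbatim from the HodgeCMPerL package; no docstring in the source.) -/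
@[simp] theorem β_eq : (torusCarrier V K L₁ L₂ m).β = β Kᗮ L₂ m := rfl

/-- (Ported verbatim from the HodgeCMPerL package; no docstring in the source.) -/
@[simp] theorem χv_apply (χ : Xw Kᗮ L₂ m) (t : Multiplicative Kᗮ × Circle) :
    (torusCarrier V K L₁ L₂ m).χv χ t = dualChar χ.1 (QuotientGroup.mk t) := rfl

/-- **AX5b holds**: every toric period `ϑ_{T,ξ} : 𝓢(V, ℂ) → C(Heis K ⧸ arith K L₁ m, ℂ)` is continuous
(pv15-g2 `KernelTorusCarrier.AX5b_holds`). -/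
theorem AX5b (χ : Xw Kᗮ L₂ m) : Continuous ((torusCarrier V K L₁ L₂ m).ϑc χ) :=
  (torusCarrier V K L₁ L₂ m).AX5b_holds (W V K L₁ L₂ m).θ_cont χ

/-- **AX12(i) holds**: `h ↦ ϑ_{T,ξ}(ω(h)Φ)` is continuous on `Heis Kᗮ` (pv15-g2 `AX12_transl_cont_holds`). -/
theorem AX12_transl_cont (χ : Xw Kᗮ L₂ m) (Φ : (W V K L₁ L₂ m).SK) :
    Continuous fun h => (torusCarrier V K L₁ L₂ m).ϑc χ ((core V K L₁ L₂ m).omg h Φ) :=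
  (torusCarrier V K L₁ L₂ m).AX12_transl_cont_holds (W V K L₁ L₂ m).θ_omg χ Φ

/-- **The unfolding identity (U) = AX12(ii) holds** in the cocompact Haar model of the nilmanifold
`[U(W)] = Heis Kᗮ ⧸ arith Kᗮ L₂ m` (pv15-g2 `KernelTorusCarrier.AX12_unfold_holds`):
`T_Φ(E_ξ f) = ∫_{Heis Kᗮ} f(h) ϑ_{T,ξ}(ω(h)Φ) dh` in `L²(Heis K ⧸ arith K L₁ m)`. -/
theorem AX12_unfold (Φ : (W V K L₁ L₂ m).SK) (χ : Xw Kᗮ L₂ m)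
    (f : CompactlySupportedContinuousMap (Heis Kᗮ) ℂ) :
    (core V K L₁ L₂ m).toRegCoreCarrier.toRepCoreCarrier.toCoreCarrier.TΦ Φ
        ((torusCarrier V K L₁ L₂ m).toRegTorusCarrier.E χ f) =
      ∫ h, f h • (core V K L₁ L₂ m).toRegCoreCarrier.inclCG
        ((torusCarrier V K L₁ L₂ m).toRegTorusCarrier.ϑc χ ((core V K L₁ L₂ m).toRegCoreCarrier.omg h Φ))
          ∂(QH Kᗮ L₂ m).μ :=
  (torusCarrier V K L₁ L₂ m).AX12_unfold_holds (QH Kᗮ L₂ m).isCocompactHaarModel (W V K L₁ L₂ m).θ_omg Φ χ f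
    ((torusCarrier V K L₁ L₂ m).AX12_transl_cont_holds (W V K L₁ L₂ m).θ_omg χ Φ)

/-- The kernel along the torus in carrier notation: `θ_Φ(xΓ₁, pt t) = Θ_Φ(incl₁ x⁻¹ · incl₂(a, 0, u))`. -/
theorem θ_pt (Φ : 𝓢(V, ℂ)) (x : Heis K) (t : Multiplicative Kᗮ × Circle) :
    (core V K L₁ L₂ m).θ ⟨Φ, Set.mem_univ Φ⟩ (QuotientGroup.mk x, (torusCarrier V K L₁ L₂ m).pt t) =
      thetaH V (lat V K L₁ L₂) m Φ (incl₁ V K x⁻¹ * incl₂ V K (Heis.ofSchrodinger t)) :=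
  pairModel_θ_torus V K L₁ L₂ m Φ x t

/-- … and at the origin of `[G_U]`: `θ_Φ(1, pt t) = uᵐ Σ_{v ∈ L} Φ(v − a)` for `t = (a, u)`. -/
theorem θ_pt_one (Φ : 𝓢(V, ℂ)) (t : Multiplicative Kᗮ × Circle) :
    (core V K L₁ L₂ m).θ ⟨Φ, Set.mem_univ Φ⟩ (QuotientGroup.mk 1, (torusCarrier V K L₁ L₂ m).pt t) =
      (t.2 : ℂ) ^ m * ∑' v : lat V K L₁ L₂, Φ ((v : V) - ((Multiplicative.toAdd t.1 : Kᗮ) : V)) :=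
  pairModel_θ_one_torus V K L₁ L₂ m Φ t

/-- **The toric period at the origin, computed** (PerL (3.9) in the model): for an allowed `ξ` and `Φ ∈ 𝓢(V, ℂ)`,
`ϑ_{T,ξ}(Φ)(1·Γ₁) = ∫_{T(𝔸)} β(t) ξ(a, 1) Σ_{v ∈ L} Φ(v − a) dν(t)` (`t = (a, u)`; the central weights `u^{-m}` of `ξ` and `uᵐ`
of the kernel cancel). -/
theorem ϑc_one (χ : Xw Kᗮ L₂ m) (Φ : 𝓢(V, ℂ)) :
    (torusCarrier V K L₁ L₂ m).ϑc χ ⟨Φ, Set.mem_univ Φ⟩ (QuotientGroup.mk 1 : Heis K ⧸ arith K L₁ m) =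
      ∫ t : Multiplicative Kᗮ × Circle,
        (β Kᗮ L₂ m t : ℂ) * dualChar χ.1 (QuotientGroup.mk (t.1, 1) : (Multiplicative Kᗮ × Circle) ⧸ ΛT Kᗮ L₂ m) *
          ∑' v : lat V K L₁ L₂, Φ ((v : V) - ((Multiplicative.toAdd t.1 : Kᗮ) : V))
        ∂(torusCarrier V K L₁ L₂ m).ν := by
  rw [KernelTorusCarrier.ϑc_apply]
  refine integral_congr_ae (Filter.Eventually.of_forall fun t => ?_)
  change (β Kᗮ L₂ m t : ℂ) * dualChar χ.1 (QuotientGroup.mk t : (Multiplicative Kᗮ × Circle) ⧸ ΛT Kᗮ L₂ m) *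
      (core V K L₁ L₂ m).θ ⟨Φ, Set.mem_univ Φ⟩ (QuotientGroup.mk 1, (torusCarrier V K L₁ L₂ m).pt t) = _
  rw [θ_pt_one, dualChar_mk_eq, Circle.coe_zpow, zpow_neg]
  have hu : ((t.2 : ℂ) ^ m) ≠ 0 := zpow_ne_zero m (Circle.coe_ne_zero t.2)
  calc (β Kᗮ L₂ m t : ℂ) * (dualChar χ.1 (QuotientGroup.mk (t.1, 1)) * ((t.2 : ℂ) ^ m)⁻¹) *
        ((t.2 : ℂ) ^ m * ∑' v : lat V K L₁ L₂, Φ ((v : V) - ((Multiplicative.toAdd t.1 : Kᗮ) : V)))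
      = (β Kᗮ L₂ m t : ℂ) * dualChar χ.1 (QuotientGroup.mk (t.1, 1)) * ((((t.2 : ℂ) ^ m)⁻¹ * (t.2 : ℂ) ^ m) *
          ∑' v : lat V K L₁ L₂, Φ ((v : V) - ((Multiplicative.toAdd t.1 : Kᗮ) : V))) := by ring
    _ = _ := by rw [inv_mul_cancel₀ hu, one_mul]

/-- … for the basic character `χ₀(a, u) = u^{-m}`: `ϑ_{T,χ₀}(Φ)(1) = ∫_{T(𝔸)} β(a, u) Σ_{v ∈ L} Φ(v − a) dν`. -/
theorem ϑc_χ₀_one (Φ : 𝓢(V, ℂ)) :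
    (torusCarrier V K L₁ L₂ m).ϑc ⟨χ₀ Kᗮ L₂ m, χ₀_mem Kᗮ L₂ m⟩ ⟨Φ, Set.mem_univ Φ⟩
        (QuotientGroup.mk 1 : Heis K ⧸ arith K L₁ m) =
      ∫ t : Multiplicative Kᗮ × Circle, (β Kᗮ L₂ m t : ℂ) *
        ∑' v : lat V K L₁ L₂, Φ ((v : V) - ((Multiplicative.toAdd t.1 : Kᗮ) : V)) ∂(torusCarrier V K L₁ L₂ m).ν := by
  rw [ϑc_one]
  simp only [dualChar_χ₀_mk, one_zpow, Circle.coe_one, mul_one]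

/-- **EVERY allowed toric period functional of the dual-pair model is non-zero**: for each `ξ ∈ X` there is a Schwartz
bump `Φ` on `V` with `ϑ_{T,ξ}(Φ)(1) ≠ 0`.  As in pv15-g5 (`ξ(·, 1)` continuous, unimodular, `L₂`-periodic; a bump of radius
`< δ` about `a₀ ∈ Kᗮ` with `β(a₀, u₀) > 0`; `|ϑ_{T,ξ}(φ)(1)| ≥ ½ ∫ β Σ_L φ > 0`), with one new step: the lattice sum runs over
`L = L₁ ⊕ L₂ ⊂ V`, and a lattice vector `v = l₁ + l₂` with `φ(v − a) ≠ 0` satisfies `‖l₂ − a + a₀‖ ≤ ‖v − a + a₀‖ < δ` by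
ORTHOGONALITY (`norm_le_norm_add_of_mem`), so that `ξ(a, 1) = ξ(a − l₂, 1)` is `½`-close to `ξ(a₀, 1)`. -/
theorem ϑc_ne_zero_of_mem (χ : Xw Kᗮ L₂ m) : ∃ Φ : (W V K L₁ L₂ m).SK,
    (torusCarrier V K L₁ L₂ m).ϑc χ Φ (QuotientGroup.mk 1 : Heis K ⧸ arith K L₁ m) ≠ 0 := by
  obtain ⟨t₀, ht₀⟩ := exists_β_ne_zero Kᗮ L₂ m
  have hD_cont : Continuous fun a : Kᗮ =>
      dualChar χ.1 (QuotientGroup.mk (Multiplicative.ofAdd a, 1) : (Multiplicative Kᗮ × Circle) ⧸ ΛT Kᗮ L₂ m) :=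
    (continuous_dualChar χ.1).comp (QuotientGroup.continuous_mk.comp (continuous_ofAdd.prodMk continuous_const))
  obtain ⟨δ, hδ, hδD⟩ := Metric.continuous_iff.mp hD_cont (Multiplicative.toAdd t₀.1) (1 / 2) one_half_pos
  obtain ⟨φ, Φ, hΦφ, hP, hr⟩ :=
    exists_bump_le V (lat V K L₁ L₂) ((Multiplicative.toAdd t₀.1 : Kᗮ) : V) hδ
  refine ⟨⟨Φ, Set.mem_univ Φ⟩, ?_⟩
  -- the real majorant `g = β · Σ_L φ(v − ·)`: continuous, compactly supported, `≥ 0`, `∫ g > 0`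
  let g : Multiplicative Kᗮ × Circle → ℝ := fun t =>
    β Kᗮ L₂ m t * ∑' v : lat V K L₁ L₂, φ ((v : V) - ((Multiplicative.toAdd t.1 : Kᗮ) : V))
  have hPc : ∀ a : V, ∑' v : lat V K L₁ L₂, Φ ((v : V) - a) =
      ((∑' v : lat V K L₁ L₂, φ ((v : V) - a) : ℝ) : ℂ) := fun a => by
    rw [Complex.ofReal_tsum]
    exact tsum_congr fun v => hΦφ _
  have hPcont : Continuous fun a : V => ∑' v : lat V K L₁ L₂, φ ((v : V) - a) := by
    refine (Complex.continuous_re.comp (continuous_periodisation V (lat V K L₁ L₂) Φ)).congr fun a => ?_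
    simp only [Function.comp_apply, hPc, Complex.ofReal_re]
  have hcoe : Continuous fun t : Multiplicative Kᗮ × Circle => ((Multiplicative.toAdd t.1 : Kᗮ) : V) :=
    continuous_subtype_val.comp (continuous_toAdd.comp continuous_fst)
  have hg_cont : Continuous g := (β Kᗮ L₂ m).continuous.mul (hPcont.comp hcoe)
  have hg_supp : HasCompactSupport g := (β Kᗮ L₂ m).hasCompactSupport.mul_right
  have hg_nonneg : 0 ≤ g := fun t => mul_nonneg (β_nonneg Kᗮ L₂ m t) (tsum_nonneg fun v => φ.nonneg)
  have hg_t₀ : g t₀ ≠ 0 := by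
    change β Kᗮ L₂ m t₀ * ∑' v : lat V K L₁ L₂, φ ((v : V) - ((Multiplicative.toAdd t₀.1 : Kᗮ) : V)) ≠ 0
    rw [hP, mul_one]
    exact ht₀
  have hg_int : Integrable g (torusCarrier V K L₁ L₂ m).ν := hg_cont.integrable_of_hasCompactSupport hg_supp
  have hpos : 0 < ∫ t, g t ∂(torusCarrier V K L₁ L₂ m).ν :=
    hg_cont.integral_pos_of_hasCompactSupport_nonneg_nonzero hg_supp hg_nonneg hg_t₀
  -- the phase along `T(𝔸)` and its value at `t₀`
  let D : Multiplicative Kᗮ × Circle → ℂ := fun t =>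
    dualChar χ.1 (QuotientGroup.mk (t.1, 1) : (Multiplicative Kᗮ × Circle) ⧸ ΛT Kᗮ L₂ m)
  have hD_cont' : Continuous D :=
    (continuous_dualChar χ.1).comp (QuotientGroup.continuous_mk.comp (continuous_fst.prodMk continuous_const))
  have hD_norm : ∀ t, ‖D t‖ = 1 := fun t => Circle.norm_coe _
  -- the integrand `H = β · D · Σ_L Φ(v − ·)` and the comparison function `D t₀ · g`
  let H : Multiplicative Kᗮ × Circle → ℂ := fun t =>
    (β Kᗮ L₂ m t : ℂ) * D t * ∑' v : lat V K L₁ L₂, Φ ((v : V) - ((Multiplicative.toAdd t.1 : Kᗮ) : V))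
  have hH_cont : Continuous H :=
    ((Complex.continuous_ofReal.comp (β Kᗮ L₂ m).continuous).mul hD_cont').mul
      ((continuous_periodisation V (lat V K L₁ L₂) Φ).comp hcoe)
  have hβC : HasCompactSupport fun t : Multiplicative Kᗮ × Circle => (β Kᗮ L₂ m t : ℂ) :=
    (β Kᗮ L₂ m).hasCompactSupport.comp_left Complex.ofReal_zero
  have hH_supp : HasCompactSupport H := (hβC.mul_right).mul_right
  have hH_int : Integrable H (torusCarrier V K L₁ L₂ m).ν := hH_cont.integrable_of_hasCompactSupport hH_supp
  have hG_int : Integrable (fun t => D t₀ * ((g t : ℝ) : ℂ)) (torusCarrier V K L₁ L₂ m).ν :=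
    hg_int.ofReal.const_mul (D t₀)
  -- POINTWISE: `‖H t − D t₀ · g t‖ ≤ g t · ½`
  have hpt : ∀ t, ‖H t - D t₀ * ((g t : ℝ) : ℂ)‖ ≤ g t * (1 / 2) := by
    intro t
    have e : H t - D t₀ * ((g t : ℝ) : ℂ) = ((g t : ℝ) : ℂ) * (D t - D t₀) := by
      change (β Kᗮ L₂ m t : ℂ) * D t * ∑' v : lat V K L₁ L₂, Φ ((v : V) - ((Multiplicative.toAdd t.1 : Kᗮ) : V)) -
          D t₀ * ((β Kᗮ L₂ m t *
            ∑' v : lat V K L₁ L₂, φ ((v : V) - ((Multiplicative.toAdd t.1 : Kᗮ) : V)) : ℝ) : ℂ) =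
        ((β Kᗮ L₂ m t * ∑' v : lat V K L₁ L₂, φ ((v : V) - ((Multiplicative.toAdd t.1 : Kᗮ) : V)) : ℝ) : ℂ) *
          (D t - D t₀)
      rw [hPc, Complex.ofReal_mul]
      ring
    rw [e, norm_mul, Complex.norm_real, Real.norm_of_nonneg (hg_nonneg t)]
    by_cases hgt : g t = 0
    · rw [hgt, zero_mul, zero_mul]
    refine mul_le_mul_of_nonneg_left ?_ (hg_nonneg t)
    -- `g t ≠ 0` ⇒ some `φ(v − a) ≠ 0`, `v = l₁ + l₂` ⇒ `a − l₂` is `δ`-close to `a₀` (orthogonality) ⇒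
    -- `D t = ξ(a − l₂, 1)` is `½`-close to `D t₀`
    have hPt : ∑' v : lat V K L₁ L₂, φ ((v : V) - ((Multiplicative.toAdd t.1 : Kᗮ) : V)) ≠ 0 := fun h0 => hgt (by
      change β Kᗮ L₂ m t * ∑' v : lat V K L₁ L₂, φ ((v : V) - ((Multiplicative.toAdd t.1 : Kᗮ) : V)) = 0
      rw [h0, mul_zero])
    obtain ⟨v, hv⟩ : ∃ v : lat V K L₁ L₂, φ ((v : V) - ((Multiplicative.toAdd t.1 : Kᗮ) : V)) ≠ 0 := by
      by_contra hall
      simp only [not_exists, not_not] at hall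
      exact hPt (by rw [tsum_congr hall, tsum_zero])
    obtain ⟨l₁, hl₁, l₂, hl₂, hv12⟩ := (mem_lat V K L₁ L₂).mp v.2
    have hvdist : dist ((v : V) - ((Multiplicative.toAdd t.1 : Kᗮ) : V)) (-((Multiplicative.toAdd t₀.1 : Kᗮ) : V)) < δ :=
      lt_of_lt_of_le (lt_of_not_ge fun h => hv (φ.zero_of_le_dist h)) hr
    have hdist : dist (Multiplicative.toAdd t.1 - l₂) (Multiplicative.toAdd t₀.1) < δ := by
      rw [dist_eq_norm, Submodule.coe_norm, Submodule.coe_sub, Submodule.coe_sub]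
      rw [dist_eq_norm, sub_neg_eq_add, ← hv12] at hvdist
      refine lt_of_le_of_lt ?_ hvdist
      have e : (l₁ : V) + (l₂ : V) - ((Multiplicative.toAdd t.1 : Kᗮ) : V) + ((Multiplicative.toAdd t₀.1 : Kᗮ) : V) =
          (l₁ : V) + ((l₂ : V) - ((Multiplicative.toAdd t.1 : Kᗮ) : V) + ((Multiplicative.toAdd t₀.1 : Kᗮ) : V)) := by
        abel
      have e' : ‖((Multiplicative.toAdd t.1 : Kᗮ) : V) - (l₂ : V) - ((Multiplicative.toAdd t₀.1 : Kᗮ) : V)‖ =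
          ‖(l₂ : V) - ((Multiplicative.toAdd t.1 : Kᗮ) : V) + ((Multiplicative.toAdd t₀.1 : Kᗮ) : V)‖ := by
        rw [← norm_neg]
        congr 1
        abel
      rw [e, e']
      exact norm_le_norm_add_of_mem V K l₁.2
        (Kᗮ.add_mem (Kᗮ.sub_mem l₂.2 (Multiplicative.toAdd t.1).2) (Multiplicative.toAdd t₀.1).2)
    have hclose := hδD (Multiplicative.toAdd t.1 - l₂) hdist
    rw [← dualChar_mk_ofAdd_sub Kᗮ L₂ m χ.1 (Multiplicative.toAdd t.1) hl₂, ofAdd_toAdd, ofAdd_toAdd, dist_eq_norm]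
      at hclose
    exact hclose.le
  -- INTEGRATE: `‖ϑ − D t₀ · ∫ g‖ ≤ ½ ∫ g`, `‖D t₀ · ∫ g‖ = ∫ g > 0`
  have hbound : ‖(∫ t, H t ∂(torusCarrier V K L₁ L₂ m).ν) -
      D t₀ * ((∫ t, g t ∂(torusCarrier V K L₁ L₂ m).ν : ℝ) : ℂ)‖
      ≤ ∫ t, g t * (1 / 2) ∂(torusCarrier V K L₁ L₂ m).ν := by
    rw [← integral_complex_ofReal, ← integral_const_mul, ← integral_sub hH_int hG_int]
    exact norm_integral_le_of_norm_le (hg_int.mul_const _) (Filter.Eventually.of_forall hpt)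
  have hGnorm : ‖D t₀ * ((∫ t, g t ∂(torusCarrier V K L₁ L₂ m).ν : ℝ) : ℂ)‖ =
      ∫ t, g t ∂(torusCarrier V K L₁ L₂ m).ν := by
    rw [norm_mul, hD_norm, one_mul, Complex.norm_real, Real.norm_of_nonneg hpos.le]
  have hhalf : ∫ t, g t * (1 / 2) ∂(torusCarrier V K L₁ L₂ m).ν =
      (∫ t, g t ∂(torusCarrier V K L₁ L₂ m).ν) * (1 / 2) :=
    integral_mul_const _ _
  have key : (∫ t, g t ∂(torusCarrier V K L₁ L₂ m).ν) * (1 / 2) ≤ ‖∫ t, H t ∂(torusCarrier V K L₁ L₂ m).ν‖ := by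
    have := norm_sub_norm_le (D t₀ * ((∫ t, g t ∂(torusCarrier V K L₁ L₂ m).ν : ℝ) : ℂ))
      (∫ t, H t ∂(torusCarrier V K L₁ L₂ m).ν)
    rw [hGnorm, ← norm_sub_rev] at this
    linarith
  rw [ϑc_one]
  intro h0
  change (∫ t, H t ∂(torusCarrier V K L₁ L₂ m).ν) = 0 at h0
  rw [h0, norm_zero] at key
  linarith

end Torus

/-! ## 6. The compact-quotient input, constructed; AX8 (`AnalyticK`) and `AnalyticU` with no hypothesis -/

section Compact

variable (V : Type) [NormedAddCommGroup V] [InnerProductSpace ℝ V] [FiniteDimensional ℝ V] [MeasurableSpace V]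
  [BorelSpace V] (K : Submodule ℝ V) (L₁ : Submodule ℤ K) [DiscreteTopology L₁] [IsZLattice ℝ L₁]
  (L₂ : Submodule ℤ Kᗮ) [DiscreteTopology L₂] [IsZLattice ℝ L₂] (m : ℤ) [NeZero m]

/-- **The compact-quotient input of the dual-pair model, CONSTRUCTED** — pv15-g5's §4 at `(Kᗮ, L₂)`: `T(L₀) := Λ = L₂ × μ_m`
(countable, closed, `[T]` compact), a fundamental domain of finite Haar measure (pv09-g4), `jT(Λ) ≤ arith Kᗮ L₂ m` (it IS the
preimage), `β` sums to one over `Λ`, `T(L₀ ⊗ ℝ) := U(1)` with its Haar probability (`ιc = inr`), `w = u^{-m}`, `E_w` by `rfl`,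
the allowed characters embedded by `Subtype.val`, finite-adelic factor `{(0, b, 1)} ≅ Kᗮ` (`modHom Kᗮ`) commuting with the
centre, and `arith · T(𝔸) · {(0, b, 1)} = Heis Kᗮ` dense (it is everything). -/
def compactInput : (torusCarrier V K L₁ L₂ m).CompactInput where
  Λ := ΛT Kᗮ L₂ m
  instΛ₂ := isClosed_ΛT Kᗮ L₂ m
  exists_fd := by
    obtain ⟨F, -, hF, -, hfin⟩ :=
      DiscreteFD.exists_isFundamentalDomain_op_finite (ΛT Kᗮ L₂ m) (torusCarrier V K L₁ L₂ m).ν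
    exact ⟨F, hF, hfin⟩
  jT_Λ := fun _ ht => ht
  β_sum := β_sum Kᗮ L₂ m
  Tc := Circle
  μ := haarCircle
  ιc := MonoidHom.inr (Multiplicative Kᗮ) Circle
  ιc_cont := (Continuous.prodMk_right 1 : Continuous fun u : Circle => ((1 : Multiplicative Kᗮ), u))
  w := weightC m
  w_cont := continuous_weightC m
  w_norm := norm_weightC m
  Ew_eq := rfl
  emb := fun χ => χ.1
  emb_spec := fun _ _ => rfl
  emb_surj := fun ξ hξ => ⟨⟨ξ, hξ⟩, rfl⟩
  Gf := Multiplicative Kᗮ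
  ιf := modHom Kᗮ
  comm := fun b u => modHom_mul_ofSchrodinger_one Kᗮ b u
  dense := fun h => subset_closure ⟨1, one_mem _, (Multiplicative.ofAdd h.a, h.u * 𝐞 ⟪h.a, h.b⟫),
    Multiplicative.ofAdd h.b, by rw [one_mul]; exact eq_ofSchrodinger_mul_modHom Kᗮ h⟩

/-- **AX8 (PerL v5 Prop. 3.6 Step 2) for the dual-pair model's torus side, with NO hypothesis**: from the cocompact Haar model of
the nilmanifold `[U(W)] = Heis Kᗮ ⧸ arith Kᗮ L₂ m`, AX1b(a) for the nilmanifold `[G_U] = Heis K ⧸ arith K L₁ m` and the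
constructed compact-quotient input (pv15-g2 `KernelTorusCarrier.analyticK_of_compactInput`). -/
theorem analyticK : (torusCarrier V K L₁ L₂ m).AnalyticK :=
  (torusCarrier V K L₁ L₂ m).analyticK_of_compactInput (QH Kᗮ L₂ m).isCocompactHaarModel
    (hatτ_complete V K L₁ L₂ m) (compactInput V K L₁ L₂ m)


-- port_pkg: scope closed for this part
end Compact
end HeisenbergPair
end SchwartzWeil
end HodgeCM
end
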